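import Literature.NumberTheory.EllipticCurves.PAdicMeasureLattice
import HarnessLib

/-!
# Moments of measures on `ℤ_p`, Greenberg's filtration `F^N 𝔻⁰_k`, and the contraction by `U_p`

For `μ` in the module `𝔻(ℤ_p)` of bounded `ℚ_p`-valued distributions (`PAdicDistributionModule`)
the **moments** are `m_j(μ) = ∫ z^j dμ` (`moment`).  Following M. Greenberg, *Lifting modular symbols
of non-critical slope*, Israel J. Math. 161 (2007), §3, the lattice `𝔻⁰` (`PAdicMeasureLattice`)
carries, for a weight `k`, the filtration

  `F^N 𝔻⁰_k = {μ ∈ 𝔻⁰ : m_i(μ) = 0 (i ≤ k),  ‖m_{k+j}(μ)‖ ≤ p^{-(N-j+1)} (j ≥ 1)}`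

(`filG k N`, a `ℤ_p`-submodule).  We prove the MOMENT FORMULA for upper-triangular matrices
`γ = (a b; 0 d)` of `Σ₀(p)` (`a ∈ ℤ_p^×`):

  `m_n(μ |_k γ) = a^{k-n} Σ_i C(n,i) b^{n-i} d^i m_i(μ)`      (`moment_weightActD_upper`),

and deduce Greenberg's Lemma 2 for such `γ` — **`F^N` is stable** (`weightActD_upper_mem_filG`) — and
the heart of every proof of Stevens' control theorem, Greenberg's Lemma 11(2) in slope `0`:
**the `U_p`-matrices `β_u = (1 u; 0 p)` map `F^N` into `F^{N+1}`** (`weightActD_beta_mem_filG_succ`).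
(The lower-triangular case of Lemma 2 needs power series under the integral sign and is left to the
next brick.)

Brick B2i of the bottom-up plan recorded with the named fact
`greenbergStevens_kitagawa_twoVariable_interpolation_allBranches`.  Everything is proved; no named facts.

## References

* M. Greenberg, *Lifting modular symbols of non-critical slope*, Israel J. Math. 161 (2007),
  141–155, §3–4 (Lemma 2, Lemma 11). [Greenberg2007Lifting]
* R. Pollack, G. Stevens, Ann. Sci. ÉNS 44 (2011), §3. [PollackStevens2011]
-/

noncomputable section

open Filter Topology

namespace Literature.NumberTheory.EllipticCurves

variable {p : ℕ} [Fact p.Prime]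

open BoundedDistribution

/-! ### Moments -/

section Moments

/-- **The `j`-th moment `m_j(μ) = ∫ z^j dμ`** of level data `μ` on `ℤ_p`. [cite: Greenberg2007Lifting, §3] -/
def moment (μ : (n : ℕ) → ZMod (p ^ n) → ℚ_[p]) (j : ℕ) : ℚ_[p] :=
  (ProfiniteTower.padicInt p).integralFn μ fun z => (z : ℚ_[p]) ^ j

/-- Unfolding `moment`. [folklore] -/
theorem moment_def (μ : (n : ℕ) → ZMod (p ^ n) → ℚ_[p]) (j : ℕ) :
    moment μ j = (ProfiniteTower.padicInt p).integralFn μ fun z => (z : ℚ_[p]) ^ j := rfl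

/-- The monomials are uniformly continuous on `ℤ_p`. [folklore] -/
theorem uniformContinuous_coe_pow (j : ℕ) : UniformContinuous fun z : ℤ_[p] => (z : ℚ_[p]) ^ j :=
  CompactSpace.uniformContinuous_of_continuous (by fun_prop)

/-- Moments are additive on `𝔻`. [folklore] -/
theorem moment_add {μ ν : (n : ℕ) → ZMod (p ^ n) → ℚ_[p]}
    (hμ : μ ∈ (ProfiniteTower.padicInt p).distributions ℚ_[p]) (hν : ν ∈ (ProfiniteTower.padicInt p).distributions ℚ_[p])
    (j : ℕ) : moment (μ + ν) j = moment μ j + moment ν j :=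
  ProfiniteTower.integralFn_add hμ hν (uniformContinuous_coe_pow j)

/-- Moments are `ℤ_p`-homogeneous on `𝔻`. [folklore] -/
theorem moment_smul {μ : (n : ℕ) → ZMod (p ^ n) → ℚ_[p]} (hμ : μ ∈ (ProfiniteTower.padicInt p).distributions ℚ_[p])
    (c : ℤ_[p]) (j : ℕ) : moment (c • μ) j = (c : ℚ_[p]) * moment μ j := by
  rw [show c • μ = (c : ℚ_[p]) • μ from rfl]
  exact ProfiniteTower.integralFn_smul (c : ℚ_[p]) hμ (uniformContinuous_coe_pow j)

/-- Moments of `μ ∈ 𝔻⁰` are integral. [cite: Greenberg2007Lifting, Lemma 1] -/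
theorem norm_moment_le_one {μ : (n : ℕ) → ZMod (p ^ n) → ℚ_[p]}
    (hμ : μ ∈ (ProfiniteTower.padicInt p).distributionsInt p) (j : ℕ) : ‖moment μ j‖ ≤ 1 := by
  have h := ((ProfiniteTower.padicInt p).toBounded₁ hμ).norm_integral_le (uniformContinuous_coe_pow j) zero_le_one
    fun z => by rw [norm_pow, PadicInt.padic_norm_e_of_padicInt]; exact pow_le_one₀ (norm_nonneg _) (PadicInt.norm_le_one z)
  rwa [ProfiniteTower.toBounded₁_bound, one_mul] at h

/-- The moment of `0` vanishes. [folklore] -/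
theorem moment_zero (j : ℕ) : moment (0 : (n : ℕ) → ZMod (p ^ n) → ℚ_[p]) j = 0 := by
  have h := moment_smul (p := p) (zero_mem _) 0 j
  rwa [zero_smul, PadicInt.coe_zero, zero_mul] at h

end Moments

/-! ### Greenberg's filtration -/

section Filtration

variable (p) in
/-- **Greenberg's filtration `F^N 𝔻⁰_k`**: integral measures whose moments of order `≤ k` vanish and
whose moment of order `k + j` (`j ≥ 1`) has norm `≤ p^{-(N-j+1)}`. [cite: Greenberg2007Lifting, §3] -/
def filG (k N : ℕ) : Submodule ℤ_[p] ((n : ℕ) → ZMod (p ^ n) → ℚ_[p]) where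
  carrier := {μ | μ ∈ (ProfiniteTower.padicInt p).distributionsInt p ∧ (∀ i ≤ k, moment μ i = 0) ∧
    ∀ j : ℕ, 1 ≤ j → ‖moment μ (k + j)‖ ≤ (p : ℝ) ^ ((j : ℤ) - 1 - N)}
  add_mem' := by
    rintro μ ν ⟨hμ, hμ0, hμ1⟩ ⟨hν, hν0, hν1⟩
    refine ⟨add_mem hμ hν, fun i hi => ?_, fun j hj => ?_⟩
    · rw [moment_add hμ.1 hν.1, hμ0 i hi, hν0 i hi, add_zero]
    · rw [moment_add hμ.1 hν.1]
      exact (IsUltrametricDist.norm_add_le_max _ _).trans (max_le (hμ1 j hj) (hν1 j hj))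
  zero_mem' := ⟨zero_mem _, fun i _ => moment_zero i, fun j _ => by rw [moment_zero, norm_zero]; positivity⟩
  smul_mem' := by
    rintro c μ ⟨hμ, hμ0, hμ1⟩
    refine ⟨Submodule.smul_mem _ c hμ, fun i hi => ?_, fun j hj => ?_⟩
    · rw [moment_smul hμ.1, hμ0 i hi, mul_zero]
    · rw [moment_smul hμ.1, norm_mul, PadicInt.padic_norm_e_of_padicInt]
      calc ‖c‖ * ‖moment μ (k + j)‖ ≤ 1 * (p : ℝ) ^ ((j : ℤ) - 1 - N) :=
          mul_le_mul (PadicInt.norm_le_one c) (hμ1 j hj) (norm_nonneg _) zero_le_one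
        _ = _ := one_mul _

/-- Membership in `F^N 𝔻⁰_k`. [folklore] -/
theorem mem_filG_iff {k N : ℕ} {μ : (n : ℕ) → ZMod (p ^ n) → ℚ_[p]} :
    μ ∈ filG p k N ↔ μ ∈ (ProfiniteTower.padicInt p).distributionsInt p ∧ (∀ i ≤ k, moment μ i = 0) ∧
      ∀ j : ℕ, 1 ≤ j → ‖moment μ (k + j)‖ ≤ (p : ℝ) ^ ((j : ℤ) - 1 - N) := Iff.rfl

/-- The filtration is decreasing. [folklore] -/
theorem filG_antitone (k : ℕ) {N N' : ℕ} (h : N ≤ N') : filG p k N' ≤ filG p k N := by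
  rintro μ ⟨hμ, h0, h1⟩
  refine ⟨hμ, h0, fun j hj => (h1 j hj).trans ?_⟩
  have hp1 : (1 : ℝ) ≤ p := by exact_mod_cast (Fact.out : p.Prime).one_lt.le
  exact zpow_le_zpow_right₀ hp1 (by omega)

/-- A uniform reformulation of the moment bounds in `F^N`: `‖m_n(μ)‖ ≤ p^{n-k-1-N}` for ALL `n`
(vacuous for `n ≤ k` where the moment vanishes, and implied by integrality for large `n`).
[folklore] -/
theorem norm_moment_le_of_mem_filG {k N : ℕ} {μ : (n : ℕ) → ZMod (p ^ n) → ℚ_[p]} (hμ : μ ∈ filG p k N)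
    (n : ℕ) : ‖moment μ n‖ ≤ (p : ℝ) ^ ((n : ℤ) - k - 1 - N) := by
  rcases le_or_gt n k with hn | hn
  · rw [hμ.2.1 n hn, norm_zero]; positivity
  · obtain ⟨j, rfl⟩ := Nat.exists_eq_add_of_lt hn
    have h := hμ.2.2 (j + 1) (by omega)
    rw [show k + (j + 1) = k + j + 1 by ring] at h
    refine h.trans_eq ?_
    congr 1
    push_cast
    ring

end Filtration

/-! ### The moment formula for upper-triangular matrices -/

section Upper

/-- The norm of `0 : ℤ_p` is `< 1`. [folklore] -/
theorem norm_zero_lt_one' : ‖(0 : ℤ_[p])‖ < 1 := by rw [norm_zero]; exact one_pos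

/-- For `c = 0` the Möbius map is affine: `γ·z = a⁻¹ (b + d z)`. [folklore] -/
theorem moebius_upper {a : ℤ_[p]} (ha : ‖a‖ = 1) (b d z : ℤ_[p]) :
    (moebius ha norm_zero_lt_one' b d z : ℚ_[p]) = ((a : ℚ_[p]))⁻¹ * ((b : ℚ_[p]) + (d : ℚ_[p]) * (z : ℚ_[p])) := by
  have h := autFactor_mul_moebius ha norm_zero_lt_one' b d z
  rw [zero_mul, add_zero] at h
  have ha0 : (a : ℚ_[p]) ≠ 0 := by
    intro h0
    rw [← PadicInt.padic_norm_e_of_padicInt, h0, norm_zero] at ha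
    exact zero_ne_one ha
  have h' : (a : ℚ_[p]) * (moebius ha norm_zero_lt_one' b d z : ℚ_[p]) = (b : ℚ_[p]) + (d : ℚ_[p]) * (z : ℚ_[p]) := by
    rw [← PadicInt.coe_mul, h]; push_cast; ring
  field_simp
  linear_combination h'

/-- The integrand of the `n`-th moment of `μ |_k γ` for upper-triangular `γ`, expanded binomially.
[folklore] -/
theorem moebius_pow_mul_autPow_upper (k n : ℕ) {a : ℤ_[p]} (ha : ‖a‖ = 1) (b d z : ℤ_[p]) :
    (moebius ha norm_zero_lt_one' b d z : ℚ_[p]) ^ n * autPow (𝕜 := ℚ_[p]) k a 0 z =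
      ((a : ℚ_[p]))⁻¹ ^ n * (a : ℚ_[p]) ^ k *
        ∑ i ∈ Finset.range (n + 1), ((n.choose i : ℕ) : ℚ_[p]) * (b : ℚ_[p]) ^ (n - i) * (d : ℚ_[p]) ^ i * (z : ℚ_[p]) ^ i := by
  rw [moebius_upper ha b d z, autPow_apply, zero_mul, add_zero, Algebra.algebraMap_self, RingHom.id_apply, PadicInt.coe_pow,
    mul_pow, add_comm ((b : ℚ_[p])), add_pow]
  rw [Finset.mul_sum, Finset.sum_mul, Finset.mul_sum]
  refine Finset.sum_congr rfl fun i _ => ?_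
  ring

/-- **The moment formula for upper-triangular `γ = (a b; 0 d) ∈ Σ₀(p)`**:
`m_n(μ |_k γ) = a^{-n} a^k Σ_{i ≤ n} C(n,i) b^{n-i} d^i m_i(μ)`. [cite: Greenberg2007Lifting, proof of Lemma 2] -/
theorem moment_weightActD_upper (k n : ℕ) {a : ℤ_[p]} (ha : ‖a‖ = 1) (b d : ℤ_[p])
    (μ : (ProfiniteTower.padicInt p).distributions ℚ_[p]) :
    moment (weightActD p ℚ_[p] k ha norm_zero_lt_one' b d μ).1 n =
      ((a : ℚ_[p]))⁻¹ ^ n * (a : ℚ_[p]) ^ k *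
        ∑ i ∈ Finset.range (n + 1), ((n.choose i : ℕ) : ℚ_[p]) * (b : ℚ_[p]) ^ (n - i) * (d : ℚ_[p]) ^ i * moment μ.1 i := by
  set D := ProfiniteTower.toBounded μ.2 with hD
  rw [moment_def, integralFn_weightActD k ha norm_zero_lt_one' b d μ (uniformContinuous_coe_pow n)]
  change D.integral (fun z => (moebius ha norm_zero_lt_one' b d z : ℚ_[p]) ^ n * autPow (𝕜 := ℚ_[p]) k a 0 z) = _
  simp_rw [moebius_pow_mul_autPow_upper k n ha b d]
  rw [D.integral_const_mul _ (uniformContinuous_finset_sum _ fun i _ =>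
      CompactSpace.uniformContinuous_of_continuous (by fun_prop)),
    D.integral_finset_sum _ fun i _ => CompactSpace.uniformContinuous_of_continuous (by fun_prop)]
  congr 1
  refine Finset.sum_congr rfl fun i _ => ?_
  rw [D.integral_const_mul _ (uniformContinuous_coe_pow i)]
  rfl

end Upper

/-! ### Greenberg's Lemma 2 (upper-triangular case) and Lemma 11(2) -/

section Greenberg

/-- Norm of a binomial-type coefficient `C(n,i) b^{n-i} d^i` is `≤ 1`. [folklore] -/
theorem norm_choose_mul_pow_mul_pow_le (n i : ℕ) (b d : ℤ_[p]) :
    ‖((n.choose i : ℕ) : ℚ_[p]) * (b : ℚ_[p]) ^ (n - i) * (d : ℚ_[p]) ^ i‖ ≤ 1 := by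
  rw [← PadicInt.coe_natCast, ← PadicInt.coe_pow, ← PadicInt.coe_pow, ← PadicInt.coe_mul, ← PadicInt.coe_mul,
    PadicInt.padic_norm_e_of_padicInt]
  exact PadicInt.norm_le_one _

/-- **Greenberg's Lemma 2, upper-triangular case: `F^N 𝔻⁰_k` is stable under `γ = (a b; 0 d) ∈ Σ₀(p)`.**
[cite: Greenberg2007Lifting, Lemma 2] -/
theorem weightActD_upper_mem_filG (k N : ℕ) {a : ℤ_[p]} (ha : ‖a‖ = 1) (b d : ℤ_[p])
    (μ : (ProfiniteTower.padicInt p).distributions ℚ_[p]) (hμ : μ.1 ∈ filG p k N) :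
    (weightActD p ℚ_[p] k ha norm_zero_lt_one' b d μ).1 ∈ filG p k N := by
  have ha' : ‖(a : ℚ_[p])‖ = 1 := by rw [PadicInt.padic_norm_e_of_padicInt, ha]
  have hlead : ∀ n, ‖((a : ℚ_[p]))⁻¹ ^ n * (a : ℚ_[p]) ^ k‖ = 1 := fun n => by
    rw [norm_mul, norm_pow, norm_pow, norm_inv, ha', inv_one, one_pow, one_pow, one_mul]
  refine ⟨weightActD_mem_distributionsInt k ha _ b d μ hμ.1, fun i hi => ?_, fun j hj => ?_⟩
  · -- moments of order `≤ k` only involve `m_0, …, m_i`, all zero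
    rw [moment_weightActD_upper]
    refine mul_eq_zero_of_right _ (Finset.sum_eq_zero fun l hl => ?_)
    rw [hμ.2.1 l (by have := Finset.mem_range.mp hl; omega), mul_zero]
  · rw [moment_weightActD_upper, norm_mul, hlead, one_mul]
    refine IsUltrametricDist.norm_sum_le_of_forall_le_of_nonneg (by positivity) fun l hl => ?_
    rw [norm_mul]
    have hl' : l ≤ k + j := by have := Finset.mem_range.mp hl; omega
    calc ‖((((k + j).choose l : ℕ) : ℚ_[p])) * (b : ℚ_[p]) ^ (k + j - l) * (d : ℚ_[p]) ^ l‖ * ‖moment μ.1 l‖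
        ≤ 1 * (p : ℝ) ^ ((l : ℤ) - k - 1 - N) :=
          mul_le_mul (norm_choose_mul_pow_mul_pow_le _ _ _ _) (norm_moment_le_of_mem_filG hμ l) (norm_nonneg _) zero_le_one
      _ ≤ (p : ℝ) ^ ((j : ℤ) - 1 - N) := by
          rw [one_mul]
          exact zpow_le_zpow_right₀ (by exact_mod_cast (Fact.out : p.Prime).one_lt.le) (by omega)

/-- **Greenberg's Lemma 11(2) in slope `0`: the `U_p`-matrices `β_u = (1 u; 0 p)` map `F^N 𝔻⁰_k` into
`F^{N+1} 𝔻⁰_k`** (the factor `p^i` in `m_{k+j}(μ|β_u) = Σ_i C(k+j,i) u^{k+j-i} p^i m_i(μ)` gains one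
level of the filtration). [cite: Greenberg2007Lifting, Lemma 11] -/
theorem weightActD_beta_mem_filG_succ (k N : ℕ) (u : ℤ_[p])
    (μ : (ProfiniteTower.padicInt p).distributions ℚ_[p]) (hμ : μ.1 ∈ filG p k N) :
    (weightActD p ℚ_[p] k (a := 1) (c := 0) norm_one norm_zero_lt_one' u (p : ℤ_[p]) μ).1 ∈ filG p k (N + 1) := by
  have hp1 : (1 : ℝ) < p := by exact_mod_cast (Fact.out : p.Prime).one_lt
  refine ⟨weightActD_mem_distributionsInt k norm_one _ u _ μ hμ.1, fun i hi => ?_, fun j hj => ?_⟩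
  · rw [moment_weightActD_upper]
    refine mul_eq_zero_of_right _ (Finset.sum_eq_zero fun l hl => ?_)
    rw [hμ.2.1 l (by have := Finset.mem_range.mp hl; omega), mul_zero]
  · rw [moment_weightActD_upper, PadicInt.coe_one, inv_one, one_pow, one_pow, one_mul, one_mul]
    refine IsUltrametricDist.norm_sum_le_of_forall_le_of_nonneg (by positivity) fun l hl => ?_
    rcases le_or_gt l k with hlk | hlk
    · rw [hμ.2.1 l hlk, mul_zero, norm_zero]; positivity
    · -- `l = k + n` with `n ≥ 1`: the term carries `p^l` and `‖m_l‖ ≤ p^{l-k-1-N}`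
      have h1 : ‖((((k + j).choose l : ℕ) : ℚ_[p]))‖ ≤ 1 := by
        rw [← PadicInt.coe_natCast, PadicInt.padic_norm_e_of_padicInt]; exact PadicInt.norm_le_one _
      have h2 : ‖(u : ℚ_[p]) ^ (k + j - l)‖ ≤ 1 := by
        rw [← PadicInt.coe_pow, PadicInt.padic_norm_e_of_padicInt]; exact PadicInt.norm_le_one _
      have h3 : ‖((p : ℤ_[p]) : ℚ_[p]) ^ l‖ = (p : ℝ) ^ (-(l : ℤ)) := by
        rw [norm_pow, PadicInt.coe_natCast, Padic.norm_p, inv_pow, ← zpow_natCast, ← zpow_neg]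
      have h4 := norm_moment_le_of_mem_filG hμ l
      have hp0 : (0 : ℝ) < (p : ℝ) ^ (-(l : ℤ)) := by positivity
      rw [norm_mul, norm_mul, norm_mul, h3]
      calc ‖((((k + j).choose l : ℕ) : ℚ_[p]))‖ * ‖(u : ℚ_[p]) ^ (k + j - l)‖ * (p : ℝ) ^ (-(l : ℤ)) * ‖moment μ.1 l‖
          ≤ 1 * 1 * (p : ℝ) ^ (-(l : ℤ)) * (p : ℝ) ^ ((l : ℤ) - k - 1 - N) := by gcongr
        _ = (p : ℝ) ^ (-(k : ℤ) - 1 - N) := by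
            rw [one_mul, one_mul, ← zpow_add₀ (by positivity)]
            congr 1; ring
        _ ≤ (p : ℝ) ^ ((j : ℤ) - 1 - (N + 1 : ℕ)) := zpow_le_zpow_right₀ hp1.le (by push_cast; omega)

end Greenberg

end Literature.NumberTheory.EllipticCurves

end
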